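import Summits.AtomisticToContinuum.HydrodynamicLimit.Theorems.RelayRaceLocalityNearConstantShortTimeHLFluxIntegrability
import Summits.AtomisticToContinuum.HydrodynamicLimit.Theorems.RelayRaceLocalityNearConstantShortTimeHLGeneralGibbs
import HarnessLib

/-!
# Crux `NearConstantShortTimeHL` (stmt-AtomisticToContinuum-12502), line `small-tilt-domination` — the position/velocity
split of the mesoscale static superlinearity `MesoscaleSuperlinearityE`

Work file of stub `stub_superlinearityE` (worker of lead c4). The registered statement `MesoscaleSuperlinearityE`
(an exponential-moment large-deviation bound, at scale `n`, for the energy-weighted capped quadratic MESOSCALE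
deviation functional `fluctuationE` under the canonical hard-sphere local Gibbs law) is NOT proved here. What is
proved is the exact reduction of the registered statement to two inputs, by disintegrating the law into its
configurational Gibbs marginal and the product Gaussian velocity law given the positions:

* `PositionMesoscaleLDWith G` — the same exponential-moment bound for a POSITION functional `G` under the
  configurational canonical Gibbs measure `posGibbsMeasure` (the mesoscale density large deviation: crux-sized);
* `VelocityMesoscaleLDWith G` — the conditional GAUSSIAN estimate: for every position configuration `x`, the
  `⊗ᵢ N(u₁(xᵢ), θ₁(xᵢ) I₃)`-exponential moment of `γ m · fluctuationE` is at most `exp(κ m + γ' m G(x))`;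
* `mesoscaleSuperlinearityE_of_split` — both together imply `MesoscaleSuperlinearityE` verbatim;

together with the measurability facts the disintegration needs (`measurable_hsExcessFreeEnergy`,
`measurable_fluctuationE`) and the intended instance of `G` (`splitFunctional = smoothedDeviation + crowding`).

References: H.-T. Yau, Lett. Math. Phys. 22 (1991) §2; C. Kipnis – C. Landim (1999) Ch. 6 (folklore reduction).
-/

noncomputable section

namespace Summit.AtomisticToContinuum.HydrodynamicLimit.Theorems.NearConstantShortTimeHL

open scoped BigOperators ENNReal
open MeasureTheory Set Filter Topology
open Literature.MathematicalPhysics.KineticTheory Literature.Analysis.FluidPDE Literature.Analysis.FunctionSpaces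

/-! ## Measurability -/

/-- The hard-sphere free volume is measurable in the density parameter (an antitone set function of the
exclusion distance, composed with `η ↦ (η/N)^{1/3}`). [folklore] -/
theorem measurable_hsFreeVolume (N : ℕ) : Measurable fun η : ℝ => hsFreeVolume η N := by
  set Φ : ℝ → ℝ≥0∞ := fun t => volume {q : Fin N → T3 | ∀ i j, i ≠ j → t < Torus.euclidDist (q i) (q j)} with hΦ
  have hanti : Antitone Φ := by
    intro s t hst
    refine measure_mono fun q hq => ?_
    intro i j hij
    exact lt_of_le_of_lt hst (hq i j hij)
  have hΦm : Measurable Φ := hanti.measurable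
  have hr : Measurable fun η : ℝ => (η / N) ^ (1 / 3 : ℝ) := (measurable_id.div_const _).pow_const _
  have : (fun η : ℝ => hsFreeVolume η N) = fun η => (Φ ((η / N) ^ (1 / 3 : ℝ))).toReal := rfl
  rw [this]
  exact (hΦm.comp hr).ennreal_toReal

/-- The hard-sphere excess free energy `f_ex` (a `limsup` of measurable functions) is measurable. [folklore] -/
theorem measurable_hsExcessFreeEnergy : Measurable hsExcessFreeEnergy := by
  have : hsExcessFreeEnergy = fun η => limsup (fun N : ℕ => -(N : ℝ)⁻¹ * Real.log (hsFreeVolume η N)) atTop := rfl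
  rw [this]
  exact Measurable.limsup fun N => measurable_const.mul (measurable_hsFreeVolume N).log

/-- The matched activity exponent `g_σ(r) = f_ex(rσ³) + rσ³ f_ex′(rσ³)` is measurable. [folklore] -/
theorem measurable_matchedExponent (σ : ℝ) :
    Measurable fun r : ℝ => hsExcessFreeEnergy (r * σ ^ 3) + r * σ ^ 3 * deriv hsExcessFreeEnergy (r * σ ^ 3) :=
  (measurable_hsExcessFreeEnergy.comp (measurable_id.mul_const _)).add
    ((measurable_id.mul_const _).mul ((measurable_deriv _).comp (measurable_id.mul_const _)))

/-- The energy-weighted fluctuation functional is measurable in the configuration (measurable profiles).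
[folklore] -/
theorem measurable_fluctuationE {m : ℕ} (ℓ : ℝ) {ρ₁ θ₁ : T3 → ℝ} {u₁ : T3 → V3} (hρ : Measurable ρ₁)
    (hθ : Measurable θ₁) (hu : Measurable u₁) :
    Measurable fun w : Config m (Fin 3) T3 => fluctuationE ℓ ρ₁ θ₁ u₁ w := by
  have hD := wg_measurable_ballDensity (W := fun p : Config m (Fin 3) T3 × T3 => p.1) (X := fun p => p.2)
    measurable_fst measurable_snd ℓ
  have hMo := wg_measurable_ballMomentum (W := fun p : Config m (Fin 3) T3 × T3 => p.1) (X := fun p => p.2)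
    measurable_fst measurable_snd ℓ
  have hE := wg_measurable_ballEnergy (W := fun p : Config m (Fin 3) T3 × T3 => p.1) (X := fun p => p.2)
    measurable_fst measurable_snd ℓ
  have hρ' : Measurable fun p : Config m (Fin 3) T3 × T3 => ρ₁ p.2 := hρ.comp measurable_snd
  have hθ' : Measurable fun p : Config m (Fin 3) T3 × T3 => θ₁ p.2 := hθ.comp measurable_snd
  have hu' : Measurable fun p : Config m (Fin 3) T3 × T3 => u₁ p.2 := hu.comp measurable_snd
  have hH : Measurable fun p : Config m (Fin 3) T3 × T3 =>
      (1 + empiricalDensityField p.1 (ballKernel ℓ p.2) + empiricalEnergyField p.1 (ballKernel ℓ p.2)) *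
        min 1 ((empiricalDensityField p.1 (ballKernel ℓ p.2) - ρ₁ p.2) ^ 2 +
          ‖empiricalMomentumField p.1 (ballKernel ℓ p.2) - ρ₁ p.2 • u₁ p.2‖ ^ 2 +
          (empiricalEnergyField p.1 (ballKernel ℓ p.2) - totalEnergyDensity (ρ₁ p.2) (u₁ p.2) (θ₁ p.2)) ^ 2) := by
    unfold totalEnergyDensity
    exact ((measurable_const.add hD).add hE).mul (measurable_const.min
      ((((hD.sub hρ').pow_const 2).add ((hMo.sub (hρ'.smul hu')).norm.pow_const 2)).add
        ((hE.sub (hρ'.mul (((hu'.norm.pow_const 2).div_const 2).add (measurable_const.mul hθ')))).pow_const 2)))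
  exact (hH.stronglyMeasurable.integral_prod_right' (ν := (volume : Measure T3))).measurable

/-! ## The two inputs of the split -/

/-- **POSITION-MARGINAL MESOSCALE LARGE DEVIATION for a position functional `G`** (input (P) of the split). Same frame
as `MesoscaleSuperlinearityE` (packing threshold `η₁`, box size `M`, `σ`, admissible family, exponent `γ`, every
`κ > 0`, eventually in `N`, uniformly over the boxed Lipschitz unit-mass profiles), with two differences: the position
side may first fix a real parameter `R` of the functional (e.g. a crowding threshold), and the bound is for the
exponential moment of `γ n_N · G R ℓ_{n_N} ρ₁ θ₁ u₁` under the CONFIGURATIONAL canonical Gibbs measure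
`posGibbsMeasure (ρ₁ e^{g_σ(ρ₁)}) ε_N n_N = Z⁻¹ 𝟙_{no overlap} ∏ᵢ ρ₁(xᵢ)e^{g_σ(ρ₁(xᵢ))} dx` (the position marginal
of the law `Q_N` of `MesoscaleSuperlinearityE`; zero measure or probability measure). [cite: Yau1991, §2] -/
def PositionMesoscaleLDWith
    (G : ℝ → ∀ {m : ℕ}, ℝ → (T3 → ℝ) → (T3 → ℝ) → (T3 → V3) → (Fin m → T3) → ℝ) : Prop :=
  ∃ η₁ : ℝ, 0 < η₁ ∧ ∀ M : ℝ, 1 ≤ M → ∀ σ : ℝ, 0 < σ →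
    let g : ℝ → ℝ := fun r => hsExcessFreeEnergy (r * σ ^ 3) + r * σ ^ 3 * deriv hsExcessFreeEnergy (r * σ ^ 3);
    ∀ (ε : ℕ → ℝ) (n : ℕ → ℕ), (∀ N, 0 < ε N) → Tendsto ε atTop (nhds 0) →
    Tendsto (fun N => (n N : ℝ) * ε N ^ 3) atTop (nhds (σ ^ 3)) →
    ∃ R : ℝ, ∃ γ : ℝ, 0 < γ ∧ ∀ κ : ℝ, 0 < κ → ∀ᶠ N : ℕ in atTop,
    ∀ (ρ₁ θ₁ : T3 → ℝ) (u₁ : T3 → V3), Continuous ρ₁ → Continuous θ₁ → Continuous u₁ → (∫ x, ρ₁ x) = 1 →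
    (∀ x, M⁻¹ ≤ ρ₁ x ∧ ρ₁ x * σ ^ 3 ≤ η₁ ∧ M⁻¹ ≤ θ₁ x ∧ θ₁ x ≤ M ∧ ‖u₁ x‖ ≤ M) →
    (∀ x y, |ρ₁ x - ρ₁ y| ≤ M * dist x y ∧ ‖u₁ x - u₁ y‖ ≤ M * dist x y ∧ |θ₁ x - θ₁ y| ≤ M * dist x y) →
    ∫⁻ x, ENNReal.ofReal (Real.exp (γ * (n N : ℝ) * G R (mesoRadius (n N)) ρ₁ θ₁ u₁ x))
        ∂posGibbsMeasure (fun x => ρ₁ x * Real.exp (g (ρ₁ x))) (ε N) (n N) ≤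
      ENNReal.ofReal (Real.exp (κ * (n N : ℝ)))

/-- **CONDITIONAL GAUSSIAN MESOSCALE ESTIMATE for a position functional `G`** (input (V) of the split). For every
box size `M ≥ 1`, density cap `ρM`, parameter `R` and target exponent `γ' > 0` there is `γ > 0` such that for every
`κ > 0`, for all sufficiently large particle numbers `m`, simultaneously for all continuous boxed Lipschitz profiles
(`M⁻¹ ≤ ρ₁ ≤ ρM`, `θ₁ ∈ [M⁻¹, M]`, `‖u₁‖ ≤ M`, all `M`-Lipschitz, `∫ρ₁ = 1`) and ALL position configurations
`x ∈ (𝕋³)^m` (no hard-core or density assumption — crowded configurations are to be charged to `G`):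
`∫ exp(γ m · fluctuationE ℓ_m ρ₁ θ₁ u₁ (x, v)) ⊗ᵢ N(u₁(xᵢ), θ₁(xᵢ) I₃)(dv) ≤ exp(κ m + γ' m · G R ℓ_m ρ₁ θ₁ u₁ x)`.
A statement about independent Gaussian velocities only. [cite: Yau1991, §2] -/
def VelocityMesoscaleLDWith
    (G : ℝ → ∀ {m : ℕ}, ℝ → (T3 → ℝ) → (T3 → ℝ) → (T3 → V3) → (Fin m → T3) → ℝ) : Prop :=
  ∀ M : ℝ, 1 ≤ M → ∀ ρM R γ' : ℝ, 0 < γ' → ∃ γ : ℝ, 0 < γ ∧ ∀ κ : ℝ, 0 < κ → ∀ᶠ m : ℕ in atTop,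
    ∀ (ρ₁ θ₁ : T3 → ℝ) (u₁ : T3 → V3), Continuous ρ₁ → Continuous θ₁ → Continuous u₁ → (∫ x, ρ₁ x) = 1 →
    (∀ x, M⁻¹ ≤ ρ₁ x ∧ ρ₁ x ≤ ρM ∧ M⁻¹ ≤ θ₁ x ∧ θ₁ x ≤ M ∧ ‖u₁ x‖ ≤ M) →
    (∀ x y, |ρ₁ x - ρ₁ y| ≤ M * dist x y ∧ ‖u₁ x - u₁ y‖ ≤ M * dist x y ∧ |θ₁ x - θ₁ y| ≤ M * dist x y) →
    ∀ x : Fin m → T3,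
    ∫⁻ v, ENNReal.ofReal (Real.exp (γ * (m : ℝ) * fluctuationE (mesoRadius m) ρ₁ θ₁ u₁ (zipConfig (x, v))))
        ∂velMeasure u₁ θ₁ x ≤
      ENNReal.ofReal (Real.exp (κ * (m : ℝ) + γ' * (m : ℝ) * G R (mesoRadius m) ρ₁ θ₁ u₁ x))

/-! ## The reduction -/

/-- **`MesoscaleSuperlinearityE` from the split.** For ANY position functional `G`: the position-marginal mesoscale
large deviation for `G` and the conditional Gaussian estimate with the same `G` imply `MesoscaleSuperlinearityE`
(disintegration of the canonical local Gibbs law into `posGibbsMeasure` and the product Gaussian velocity law,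
`lintegral_canonicalLaw`; the particle number of an admissible family diverges). [cite: Yau1991, §2] -/
theorem mesoscaleSuperlinearityE_of_split
    (G : ℝ → ∀ {m : ℕ}, ℝ → (T3 → ℝ) → (T3 → ℝ) → (T3 → V3) → (Fin m → T3) → ℝ)
    (hP : PositionMesoscaleLDWith G) (hV : VelocityMesoscaleLDWith G) : MesoscaleSuperlinearityE := by
  obtain ⟨η₁, hη₁, hP⟩ := hP
  refine ⟨η₁, hη₁, ?_⟩
  intro M hM σ hσ g ε n hε hε0 hnε
  obtain ⟨R, γ', hγ', hP'⟩ := hP M hM σ hσ ε n hε hε0 hnε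
  obtain ⟨γ, hγ, hV'⟩ := hV M hM (η₁ / σ ^ 3) R γ' hγ'
  refine ⟨γ, hγ, fun κ hκ => ?_⟩
  have hκ2 : 0 < κ / 2 := half_pos hκ
  have hn_top : Tendsto n atTop atTop := tendsto_atTop_of_tendsto_mul_pow_three hσ hε hε0 hnε
  filter_upwards [hP' (κ / 2) hκ2, hn_top.eventually (hV' (κ / 2) hκ2)] with N hPN hVN
  intro ρ₁ θ₁ u₁ hρc hθc huc hρ1 hbox hlip
  have hM0 : 0 < M := lt_of_lt_of_le one_pos hM
  have hMi : 0 < M⁻¹ := inv_pos.2 hM0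
  have hσ3 : 0 < σ ^ 3 := pow_pos hσ 3
  have hρpos : ∀ x, 0 < ρ₁ x := fun x => hMi.trans_le (hbox x).1
  have hθ0 : ∀ x, 0 < θ₁ x := fun x => hMi.trans_le (hbox x).2.2.1
  -- the activity
  set a : T3 → ℝ := fun x => ρ₁ x * Real.exp (g (ρ₁ x)) with ha_def
  have ha : Measurable a :=
    hρc.measurable.mul (Real.measurable_exp.comp ((measurable_matchedExponent σ).comp hρc.measurable))
  have ha0 : ∀ x, 0 ≤ a x := fun x => mul_nonneg (hρpos x).le (Real.exp_pos _).le
  -- the box of the velocity lemma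
  have hbox' : ∀ x, M⁻¹ ≤ ρ₁ x ∧ ρ₁ x ≤ η₁ / σ ^ 3 ∧ M⁻¹ ≤ θ₁ x ∧ θ₁ x ≤ M ∧ ‖u₁ x‖ ≤ M := fun x =>
    ⟨(hbox x).1, by rw [le_div_iff₀ hσ3]; exact (hbox x).2.1, (hbox x).2.2⟩
  have hVx := hVN ρ₁ θ₁ u₁ hρc hθc huc hρ1 hbox' hlip
  have hPx := hPN ρ₁ θ₁ u₁ hρc hθc huc hρ1 hbox hlip
  -- measurability of the integrand
  have hFm : Measurable fun w : Config (n N) (Fin 3) T3 =>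
      ENNReal.ofReal (Real.exp (γ * (n N : ℝ) * fluctuationE (mesoRadius (n N)) ρ₁ θ₁ u₁ w)) :=
    (measurable_const.mul (measurable_fluctuationE _ hρc.measurable hθc.measurable huc.measurable)).exp.ennreal_ofReal
  -- disintegrate
  dsimp only
  rw [liouville_withDensity_canonicalDensity, lintegral_canonicalLaw ha hθc.measurable huc.measurable ha0 hθ0 _ _ hFm]
  -- the density of the position marginal
  have hdens : Measurable fun x : Fin (n N) → T3 =>
      ENNReal.ofReal ((posPartition a (ε N) (n N))⁻¹ * posWeight a (ε N) (n N) x) :=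
    (measurable_const.mul (BlockGibbsLine.measurable_posWeight' ha _ _)).ennreal_ofReal
  have hPx' : ∫⁻ x, ENNReal.ofReal ((posPartition a (ε N) (n N))⁻¹ * posWeight a (ε N) (n N) x) *
      ENNReal.ofReal (Real.exp (γ' * (n N : ℝ) * G R (mesoRadius (n N)) ρ₁ θ₁ u₁ x)) ≤
      ENNReal.ofReal (Real.exp (κ / 2 * (n N : ℝ))) := by
    have h := hPx
    rw [posGibbsMeasure, lintegral_withDensity_eq_lintegral_mul_non_measurable _ hdens
      (Eventually.of_forall fun _ => ENNReal.ofReal_lt_top)] at h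
    exact h
  calc ∫⁻ x, ENNReal.ofReal ((posPartition a (ε N) (n N))⁻¹ * posWeight a (ε N) (n N) x) *
        ∫⁻ v, ENNReal.ofReal (Real.exp (γ * (n N : ℝ) *
          fluctuationE (mesoRadius (n N)) ρ₁ θ₁ u₁ (zipConfig (x, v)))) ∂velMeasure u₁ θ₁ x
      ≤ ∫⁻ x, ENNReal.ofReal ((posPartition a (ε N) (n N))⁻¹ * posWeight a (ε N) (n N) x) *
          (ENNReal.ofReal (Real.exp (κ / 2 * (n N : ℝ))) *
            ENNReal.ofReal (Real.exp (γ' * (n N : ℝ) * G R (mesoRadius (n N)) ρ₁ θ₁ u₁ x))) := by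
        refine lintegral_mono fun x => mul_le_mul_right ?_ _
        rw [← ENNReal.ofReal_mul (Real.exp_nonneg _), ← Real.exp_add]
        exact hVx x
    _ = ENNReal.ofReal (Real.exp (κ / 2 * (n N : ℝ))) *
          ∫⁻ x, ENNReal.ofReal ((posPartition a (ε N) (n N))⁻¹ * posWeight a (ε N) (n N) x) *
            ENNReal.ofReal (Real.exp (γ' * (n N : ℝ) * G R (mesoRadius (n N)) ρ₁ θ₁ u₁ x)) := by
        rw [← lintegral_const_mul' _ _ ENNReal.ofReal_ne_top]
        refine lintegral_congr fun x => ?_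
        ring
    _ ≤ ENNReal.ofReal (Real.exp (κ / 2 * (n N : ℝ))) * ENNReal.ofReal (Real.exp (κ / 2 * (n N : ℝ))) :=
        mul_le_mul_right hPx' _
    _ = ENNReal.ofReal (Real.exp (κ * (n N : ℝ))) := by
        rw [← ENNReal.ofReal_mul (Real.exp_nonneg _), ← Real.exp_add]
        congr 1
        ring

/-! ## The intended position functional and the two closed statements

The functional `G` the velocity estimate produces (blueprint in the docstring of `VelocityMesoscaleLD`):
`splitFunctional R = smoothedDeviation + crowding R`. -/

/-- The number of particles of the position configuration `x` at minimal-image distance `< r` from `y`. [folklore] -/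
def nearCount {m : ℕ} (r : ℝ) (y : T3) (x : Fin m → T3) : ℕ :=
  (Finset.univ.filter fun j => Torus.euclidDist y (x j) < r).card

/-- **Crowding fraction** at threshold `R` and radius `ℓ`: the fraction of the `m` particles having more than
`R · mℓ³` particles within minimal-image distance `12ℓ` (`mℓ³ = m^{1/4}` particles is the nominal ball content at
`ℓ = m^{-1/4}`). On the hard-sphere domain of `m` spheres of diameter `ε` with `mε³ ≥ σ³/2` and `12ℓ + ε/2 < 1/2` it
vanishes identically once `R ≥ 2·48³/σ³` (packing, `card_filter_near_le`). [folklore] -/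
def crowding {m : ℕ} (R ℓ : ℝ) (x : Fin m → T3) : ℝ :=
  (m : ℝ)⁻¹ * ((Finset.univ.filter fun i => R * ((m : ℝ) * ℓ ^ 3) < (nearCount (12 * ℓ) (x i) x : ℝ)).card : ℝ)

/-- **Smoothed-profile mesoscale deviation** of a position configuration `x` from `(ρ₁, u₁, θ₁)` (positions only):
the functional `fluctuation` with the momentum / energy ball averages replaced by their conditional Gaussian means
given the positions, `m̄(y) = m⁻¹ Σᵢ K(y,xᵢ) u₁(xᵢ)`, `ē(y) = m⁻¹ Σᵢ K(y,xᵢ)(‖u₁(xᵢ)‖²/2 + 3θ₁(xᵢ)/2)`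
(`K = ballKernel ℓ`), weight `1 + ρ̃(y)`:
`∫ (1 + ρ̃) min 1 ((ρ̃ − ρ₁)² + ‖m̄ − ρ₁u₁‖² + (ē − E(ρ₁,u₁,θ₁))²) dy`. For `M`-Lipschitz profiles
`‖m̄ − ρ̃ u₁‖ ≤ √3 Mℓ ρ̃` and `|ē − ρ̃(‖u₁‖²/2 + 3θ₁/2)| ≤ √3(M² + 3M/2)ℓ ρ̃`, so on the hard-sphere domain (where
`ρ̃ ≤ C/σ³`) it is `≤ C_M · ∫ (1 + ρ̃) min 1 (ρ̃ − ρ₁)² + C_{M,σ} ℓ²`. [cite: Yau1991, §2] -/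
def smoothedDeviation {m : ℕ} (ℓ : ℝ) (ρ₁ θ₁ : T3 → ℝ) (u₁ : T3 → V3) (x : Fin m → T3) : ℝ :=
  ∫ y, (1 + (m : ℝ)⁻¹ * ∑ i, ballKernel ℓ y (x i)) *
    min 1 (((m : ℝ)⁻¹ * ∑ i, ballKernel ℓ y (x i) - ρ₁ y) ^ 2 +
      ‖(m : ℝ)⁻¹ • ∑ i, ballKernel ℓ y (x i) • u₁ (x i) - ρ₁ y • u₁ y‖ ^ 2 +
      ((m : ℝ)⁻¹ * ∑ i, ballKernel ℓ y (x i) * (‖u₁ (x i)‖ ^ 2 / 2 + 3 / 2 * θ₁ (x i)) -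
        totalEnergyDensity (ρ₁ y) (u₁ y) (θ₁ y)) ^ 2)

/-- The position functional of the split: smoothed-profile deviation plus crowding fraction. [folklore] -/
def splitFunctional (R : ℝ) {m : ℕ} (ℓ : ℝ) (ρ₁ θ₁ : T3 → ℝ) (u₁ : T3 → V3) (x : Fin m → T3) : ℝ :=
  smoothedDeviation ℓ ρ₁ θ₁ u₁ x + crowding R ℓ x

/-- **POSITION-MARGINAL MESOSCALE LARGE DEVIATION** (the crux-sized static input). `PositionMesoscaleLDWith` for
`splitFunctional`: ∃ packing threshold `η₁ > 0`, ∀ `M ≥ 1`, `σ > 0`, admissible family, ∃ crowding threshold `R`,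
∃ `γ > 0`, ∀ `κ > 0`, eventually in `N`, for all boxed Lipschitz unit-mass profiles,
`∫ exp(γ n_N (smoothedDeviation ℓ ρ₁ θ₁ u₁ + crowding R ℓ)) d posGibbs(ρ₁e^{g_σ(ρ₁)}, ε_N, n_N) ≤ exp(κ n_N)`,
`ℓ = n_N^{-1/4}`. With `R = 2·48³/σ³` the crowding term vanishes on the support (packing) and the bias terms of
`smoothedDeviation` are `O_{M,σ}(ℓ²)` there, so this is the pure mesoscale DENSITY large deviation of the canonical
hard-sphere gas with slowly varying activity at small packing: balls of `≍ n^{1/4}` particles, local rates linear in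
the ball particle number (canonical cluster expansion), product over `≍ n^{3/4}` balls, `log E ≤ C n^{3/4} = o(n)`.
No published theorem states it for continuum hard spheres. [cite: Yau1991, §2] [cite: PulvirentiTsagkarogiannis2012, Thm 2.1] -/
@[conjecture] def PositionMesoscaleLD : Prop :=
  PositionMesoscaleLDWith splitFunctional

/-- **CONDITIONAL GAUSSIAN MESOSCALE ESTIMATE** (the tractable velocity input). `VelocityMesoscaleLDWith` for
`splitFunctional`. Blueprint (given the positions `x`, `vᵢ ∼ N(u₁(xᵢ), θ₁(xᵢ)I₃)` independent; `N₀ = m^{1/4}`):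
write `m̃ = m̄ + μ`, `ẽ = ē + ζ`, `D ≤ 2D_p + 2D_v` with `D_v = ‖μ‖² + ζ²`, weight `1 + ρ̃ + ẽ ≤ 1 + (1+c_M)ρ̃ + |ζ|`;
then `fluctuationE ≤ 2(1+c_M)·[(1+ρ̃) min 1 D_p] + 2|ζ| min 1 D_p + 2(2+(1+c_M)ρ̃) min 1 D_v + 2|ζ| 𝟙{|ζ|>1}`
pointwise in `y`. Hölder over the four terms: (1) is `smoothedDeviation`; (2) `E exp(6γ Σᵢ wᵢ|Yᵢ|) ≤
exp(6γ c_M m · smoothedDeviation)` (`wᵢ = ∫ K(y,xᵢ) min 1 D_p ≤ 1`, `Yᵢ = ‖vᵢ‖²/2 − ‖u₁(xᵢ)‖²/2 − 3θ₁(xᵢ)/2`,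
one-particle Gaussian moment `lintegral_exp_kinetic_gaussMeasure_le`); (3),(4) by a chessboard of cells of side
`L ∈ [2ℓ, 4ℓ]`, 8 colours (Hölder), independence of same-colour cells, Jensen over `y` in a cell (`mL³ ≤ 64 N₀`): per
`y`, if the ball holds `≤ R N₀` particles the capped quadratic forms `min(aN₀, a S²/N₀)` of the centred Gaussian /
chi-square sums have exponential moment `≤ B(M,R)` for `γ ≤ γ₀(M,R)` (Bernstein two-regime tail + the cap), else the
deterministic bound `exp(γ C_M N_y)` is charged to `crowding R` (a crowded ball forces `> R N₀` particles within `12ℓ`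
of each of its particles; each particle lies in `≤ 8` enlarged cells); total `B^{m^{3/4}} · exp(γ C(M,R) m ·
splitFunctional) ≤ exp(κ m + γ' m · splitFunctional)` for `γ ≤ γ'/C(M,R)`, `m ≥ m₀(κ, M, R)`. [cite: Yau1991, §2] -/
@[conjecture] def VelocityMesoscaleLD : Prop :=
  VelocityMesoscaleLDWith splitFunctional

/-- **MESOSCALE DENSITY LARGE DEVIATION** (the core of `PositionMesoscaleLD`, stated separately so that it can be
registered on its own): the same frame with the pure density functional `∫ (1 + ρ̃) min 1 (ρ̃ − ρ₁)² dy` of the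
positions (`ρ̃(y) = m⁻¹ Σᵢ ballKernel ℓ y xᵢ`; the parameter `R` and the profiles `θ₁, u₁` are not used). Expected
(elementary, NOT proved here): `PositionMesoscaleLD` follows from it by packing on the support of `posGibbsMeasure`
(`crowding R = 0` for `R = 2·48³/σ³`, `ρ̃ ≤ C/σ³`, bias of `smoothedDeviation` `O_{M,σ}(ℓ²)`, `γ ↦ γ/C_M`).
[cite: Yau1991, §2] [cite: PulvirentiTsagkarogiannis2012, Thm 2.1] -/
@[conjecture] def MesoscaleDensityLD : Prop :=
  PositionMesoscaleLDWith fun (_ : ℝ) {m : ℕ} (ℓ : ℝ) (ρ₁ _ : T3 → ℝ) (_ : T3 → V3) (x : Fin m → T3) =>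
    ∫ y, (1 + (m : ℝ)⁻¹ * ∑ i, ballKernel ℓ y (x i)) *
      min 1 (((m : ℝ)⁻¹ * ∑ i, ballKernel ℓ y (x i) - ρ₁ y) ^ 2)

/-- **`MesoscaleSuperlinearityE` ⇐ `PositionMesoscaleLD ∧ VelocityMesoscaleLD`.** [cite: Yau1991, §2] -/
theorem mesoscaleSuperlinearityE_of (hP : PositionMesoscaleLD) (hV : VelocityMesoscaleLD) :
    MesoscaleSuperlinearityE :=
  mesoscaleSuperlinearityE_of_split _ hP hV

end Summit.AtomisticToContinuum.HydrodynamicLimit.Theorems.NearConstantShortTimeHL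

end
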